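import Mathlib
import HarnessLib
import Summits.QuantumAdvantage.AdviceFreeQNC0.TwistBound

set_option linter.dupNamespace false
set_option autoImplicit false

/-!
# DigitDial (A) — twisted transfer for a GENERAL modulus `M` (cell decomp-qadv, lens 4, g20)

Prop-definition-free tree twin of §1 of the lens-4 g20 node `DigitDial` (supports the symmetric / weight-residue sub-case of
item OddPrimeWalk:23109 `ManyReadersSqrtOdd`).  The tree's `TwistedTransfer.Site` machinery (`TwistBound.lean`) bounds the
correlation of the u-walk win indicator of a CONSTANT firing set with an additive character of the Hamming weight taken in
`ℤ/p`; every proof there is modulus-agnostic, and this file records the same bounds for an arbitrary modulus `M`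
(`[NeZero M]` in place of `[Fact p.Prime]`):
* `TwistM.corr_win_le` — `‖Σ_u WIN_Y(u)·ψ(|u|)‖` is controlled by the product of the site contraction factors;
* `TwistM.site_contract` — for `3 ∤ M` and `a ≠ 0` one site twisted by `e_M(a·)` contracts the transfer energy by
  `cos(π/(3M))²` (from `TwoModuli.sum_norm_sq_twistStep_three_le'`);
* `TwistM.corr_win_weight_le` — the resulting bound `‖Σ_u WIN_Y(u)·e_M(a|u|)‖ ≤ 3·cos(π/(3M))ⁿ·2ⁿ`.
0 sorry; axioms standard; no `instance`, no `notation`, no `native_decide`; no `def … : Prop`.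
-/

noncomputable section

namespace Summit.QuantumAdvantage.QuantumAdvantage.Theorems.DigitDial

open Finset Summit.QuantumAdvantage.AdviceFreeQNC0 Literature.Computability.MetaComplexity
open TwistedTransfer ConstBells

/-! ## §1  Twisted transfer for a GENERAL modulus `M` (the tree's `TwistedTransfer.Site` section verbatim with
`[Fact p.Prime]` replaced by `[NeZero M]`; every proof is modulus-agnostic) -/

namespace TwistM

variable {n : ℕ} {M : ℕ} [NeZero M]

/-- The site phases `ζ_i = e_M(β_i)` (and `1` beyond the input length). -/
def phaseM (β : Fin n → ZMod M) (i : ℕ) : ℂ := if h : i < n then (ZMod.stdAddChar (β ⟨i, h⟩) : ℂ) else 1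

/-- The linear phase of an input is the product of the site phases of its set bits. -/
theorem char_eq_prod (β : Fin n → ZMod M) (u : Fin n → Bool) :
    (ZMod.stdAddChar (∑ i : Fin n, if u i then β i else 0) : ℂ) = ∏ i : Fin n, (if u i then phaseM β i.val else 1) := by
  rw [TwoModuli.stdAddChar_sum_ite β u]
  refine Finset.prod_congr rfl fun i _ => ?_
  unfold phaseM
  by_cases hu : u i = true
  · rw [if_pos hu, if_pos hu, dif_pos i.isLt]
  · rw [if_neg hu, if_neg hu]

/-- The per-site contraction factors. -/
def siteRhoM (β : Fin n → ZMod M) (ρ : ℝ) (i : ℕ) : ℝ :=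
  if h : i < n then (if β ⟨i, h⟩ = 0 then 1 else ρ) else 1

omit [NeZero M] in
/-- `Π_{i<n} siteRhoM² = (ρ²)^{#supp β}`. -/
theorem prod_siteRhoM_sq (β : Fin n → ZMod M) (ρ : ℝ) :
    (∏ i ∈ range n, siteRhoM β ρ (0 + i) ^ 2) = (ρ ^ 2) ^ (univ.filter fun i : Fin n => β i ≠ 0).card := by
  classical
  simp only [zero_add]
  rw [← Fin.prod_univ_eq_prod_range (fun i => siteRhoM β ρ i ^ 2) n]
  have h : ∀ i : Fin n, siteRhoM β ρ i.val ^ 2 = if β i ≠ 0 then ρ ^ 2 else 1 := by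
    intro i
    unfold siteRhoM
    rw [dif_pos i.isLt]
    by_cases hb : β i = 0
    · rw [if_pos hb, if_neg (not_not.2 hb), one_pow]
    · rw [if_neg hb, if_pos hb]
  rw [Finset.prod_congr rfl (fun i _ => h i), Finset.prod_ite, Finset.prod_const, Finset.prod_const_one, mul_one]

/-- The twisted sum `Σ_u sgnU(u)·e_M(⟨β,u⟩)` of a constant strategy `B` in transfer form. -/
theorem sum_sgnU_char (c : ℕ) (B : Finset (Fin (n + 1))) (β : Fin n → ZMod M) :
    (∑ u : Fin n → Bool, (sgnU c B u : ℂ) * ∏ i : Fin n, (if u i then phaseM β i.val else 1)) =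
      ∑ τ : ZMod 3, (2 : ℂ) ^ n * TBV (phaseM β) (fT (bellsN B) n (((c + 2 * n : ℕ) : ZMod 3)) τ) 0 n 0 := by
  have h : ∀ u : Fin n → Bool, (sgnU c B u : ℂ) * ∏ i : Fin n, (if u i then phaseM β i.val else 1) =
      ∑ τ : ZMod 3, ((∏ j ∈ range (n + 1), fT (bellsN B) n (((c + 2 * n : ℕ) : ZMod 3)) τ (0 + j)
        (0 + ((j + wtPrefix u j : ℕ) : ZMod 3)) : ℝ) : ℂ) * ∏ i : Fin n, (if u i then phaseM β (0 + i.val) else 1) := by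
    intro u
    rw [sgnU_eq_sum, Complex.ofReal_sum, Finset.sum_mul]
    simp only [zero_add]
    rfl
  simp_rw [h]
  rw [Finset.sum_comm]
  refine Finset.sum_congr rfl fun τ _ => ?_
  exact twisted_pathSum_eq (phaseM β) _ n 0 0

/-- The bound on one twisted transfer vector: `|TBV_0(0)| ≤ ρ^{#supp β}`. -/
theorem norm_TBV_le {ρ : ℝ} (hρ : 0 ≤ ρ)
    (hsite : ∀ a : ZMod M, a ≠ 0 → ∀ v : ZMod 3 → ℂ, cnsq (twAvg (ZMod.stdAddChar a) v) ≤ ρ ^ 2 * cnsq v)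
    (β : Fin n → ZMod M) (BN : Finset ℕ) (κ τ : ZMod 3) :
    ‖TBV (phaseM β) (fT BN n κ τ) 0 n 0‖ ≤ ρ ^ (univ.filter fun i : Fin n => β i ≠ 0).card := by
  have hρsite : ∀ g v, cnsq (twAvg (phaseM β g) v) ≤ siteRhoM β ρ g ^ 2 * cnsq v := by
    intro g v
    unfold phaseM siteRhoM
    by_cases hg : g < n
    · rw [dif_pos hg, dif_pos hg]
      by_cases hb : β ⟨g, hg⟩ = 0
      · rw [if_pos hb, hb, AddChar.map_zero_eq_one, one_pow, one_mul]
        exact cnsq_twAvg_le (by simp) v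
      · rw [if_neg hb]
        exact hsite _ hb v
    · rw [dif_neg hg, dif_neg hg, one_pow, one_mul]
      exact cnsq_twAvg_le (by simp) v
  have h1 := cnsq_TBV_le (phaseM β) (fT BN n κ τ) (fT_sq_le BN n κ τ) (siteRhoM β ρ) hρsite n 0
  rw [prod_siteRhoM_sq, zero_add, TBV_zero, cnsq_ofReal] at h1
  have h2 : cnsq (TBV (phaseM β) (fT BN n κ τ) 0 n) ≤ (ρ ^ 2) ^ (univ.filter fun i : Fin n => β i ≠ 0).card := by
    refine h1.trans ?_
    have := nsq_fT_last BN n κ τ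
    have h0 : 0 ≤ (ρ ^ 2) ^ (univ.filter fun i : Fin n => β i ≠ 0).card := by positivity
    nlinarith
  have h3 : ‖TBV (phaseM β) (fT BN n κ τ) 0 n 0‖ ^ 2 ≤ (ρ ^ (univ.filter fun i : Fin n => β i ≠ 0).card) ^ 2 := by
    rw [← pow_mul, mul_comm, pow_mul]
    exact (normSq_le_cnsq _ 0).trans h2
  have h4 := abs_le_of_sq_le_sq h3 (by positivity)
  rwa [abs_norm] at h4

/-- The twisted sum of a constant strategy is small: `|Σ_u sgnU(u) e_M(⟨β,u⟩)| ≤ 3·ρ^{#supp β}·2ⁿ`. -/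
theorem norm_sum_sgnU_char_le {ρ : ℝ} (hρ : 0 ≤ ρ)
    (hsite : ∀ a : ZMod M, a ≠ 0 → ∀ v : ZMod 3 → ℂ, cnsq (twAvg (ZMod.stdAddChar a) v) ≤ ρ ^ 2 * cnsq v)
    (c : ℕ) (B : Finset (Fin (n + 1))) (β : Fin n → ZMod M) :
    ‖∑ u : Fin n → Bool, (sgnU c B u : ℂ) * ∏ i : Fin n, (if u i then phaseM β i.val else 1)‖ ≤
      3 * ρ ^ (univ.filter fun i : Fin n => β i ≠ 0).card * (2 : ℝ) ^ n := by
  rw [sum_sgnU_char]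
  set s := (univ.filter fun i : Fin n => β i ≠ 0).card
  have hτ : ∀ τ : ZMod 3, ‖(2 : ℂ) ^ n * TBV (phaseM β) (fT (bellsN B) n (((c + 2 * n : ℕ) : ZMod 3)) τ) 0 n 0‖ ≤
      (2 : ℝ) ^ n * ρ ^ s := by
    intro τ
    rw [norm_mul, norm_pow, Complex.norm_ofNat]
    exact mul_le_mul_of_nonneg_left (norm_TBV_le hρ hsite β _ _ τ) (by positivity)
  have h3 : (∑ τ : ZMod 3, ‖(2 : ℂ) ^ n * TBV (phaseM β) (fT (bellsN B) n (((c + 2 * n : ℕ) : ZMod 3)) τ) 0 n 0‖) =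
      ‖(2 : ℂ) ^ n * TBV (phaseM β) (fT (bellsN B) n (((c + 2 * n : ℕ) : ZMod 3)) 0) 0 n 0‖ +
      ‖(2 : ℂ) ^ n * TBV (phaseM β) (fT (bellsN B) n (((c + 2 * n : ℕ) : ZMod 3)) 1) 0 n 0‖ +
      ‖(2 : ℂ) ^ n * TBV (phaseM β) (fT (bellsN B) n (((c + 2 * n : ℕ) : ZMod 3)) 2) 0 n 0‖ :=
    Fin.sum_univ_three _
  refine (norm_sum_le _ _).trans ?_
  rw [h3]
  have t0 := hτ 0; have t1 := hτ 1; have t2 := hτ 2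
  linarith

/-- **Correlation bound from the per-site contraction** (general modulus): for every oblivious firing set `Y`,
charge `c` and phase vector `β ∈ (ℤ/M)ⁿ`, `|Σ_u [WIN_Y(u)]·e_M(⟨β,u⟩)| ≤ 3·ρ^{#supp β}·2ⁿ`. -/
theorem corr_win_le {ρ : ℝ} (hρ : 0 ≤ ρ)
    (hsite : ∀ a : ZMod M, a ≠ 0 → ∀ v : ZMod 3 → ℂ, cnsq (twAvg (ZMod.stdAddChar a) v) ≤ ρ ^ 2 * cnsq v)
    (c : ℕ) (Y : Finset (Fin (n + 1))) (β : Fin n → ZMod M) :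
    ‖∑ u : Fin n → Bool, (if ringWinU c (fun g _ => decide (g ∈ Y)) u = true then (1 : ℂ) else 0) *
        (ZMod.stdAddChar (∑ i : Fin n, if u i then β i else 0) : ℂ)‖ ≤
      3 * ρ ^ (univ.filter fun i : Fin n => β i ≠ 0).card * (2 : ℝ) ^ n := by
  set s := (univ.filter fun i : Fin n => β i ≠ 0).card with hs
  have hterm : ∀ u : Fin n → Bool, (if ringWinU c (fun g _ => decide (g ∈ Y)) u = true then (1 : ℂ) else 0) *
      (ZMod.stdAddChar (∑ i : Fin n, if u i then β i else 0) : ℂ) =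
      (1 / 2) * ((sgnU c (∅ : Finset (Fin (n + 1))) u : ℂ) * ∏ i : Fin n, (if u i then phaseM β i.val else 1)) -
      (1 / 2) * ((sgnU c Y u : ℂ) * ∏ i : Fin n, (if u i then phaseM β i.val else 1)) := by
    intro u
    rw [win_indicator_eq, char_eq_prod, sgnU_empty]
    push_cast; ring
  simp_rw [hterm]
  rw [Finset.sum_sub_distrib, ← Finset.mul_sum, ← Finset.mul_sum]
  have hA := norm_sum_sgnU_char_le hρ hsite c (∅ : Finset (Fin (n + 1))) β
  have hB := norm_sum_sgnU_char_le hρ hsite c Y β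
  calc ‖(1 / 2 : ℂ) * (∑ u : Fin n → Bool, (sgnU c (∅ : Finset (Fin (n + 1))) u : ℂ) *
          ∏ i : Fin n, (if u i then phaseM β i.val else 1)) -
        (1 / 2 : ℂ) * (∑ u : Fin n → Bool, (sgnU c Y u : ℂ) * ∏ i : Fin n, (if u i then phaseM β i.val else 1))‖
      ≤ ‖(1 / 2 : ℂ) * (∑ u : Fin n → Bool, (sgnU c (∅ : Finset (Fin (n + 1))) u : ℂ) *
          ∏ i : Fin n, (if u i then phaseM β i.val else 1))‖ +
        ‖(1 / 2 : ℂ) * (∑ u : Fin n → Bool, (sgnU c Y u : ℂ) * ∏ i : Fin n, (if u i then phaseM β i.val else 1))‖ :=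
        norm_sub_le _ _
    _ ≤ 1 / 2 * (3 * ρ ^ s * (2 : ℝ) ^ n) + 1 / 2 * (3 * ρ ^ s * (2 : ℝ) ^ n) := by
        rw [norm_mul, norm_mul, show ‖(1 / 2 : ℂ)‖ = 1 / 2 from by norm_num]
        gcongr
    _ = 3 * ρ ^ s * (2 : ℝ) ^ n := by ring

/-- **Per-site contraction for a general modulus coprime to `3`** (qn-lit's `TwoModuli.sum_norm_sq_twistStep_three_le'`,
[DavisRabinowitz1984] via the sharp norm `cos(π/(3M))` of `½(S + e_M(a)S²)` on `ℂ^{ℤ/3}`, `a ≠ 0`, `3 ∤ M`). -/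
theorem site_contract (hM3 : M.Coprime 3) {a : ZMod M} (ha : a ≠ 0) (v : ZMod 3 → ℂ) :
    cnsq (twAvg (ZMod.stdAddChar a) v) ≤ Real.cos (Real.pi / (3 * M)) ^ 2 * cnsq v := by
  have h := TwoModuli.sum_norm_sq_twistStep_three_le' hM3 ha 1 2 v
  have hl : (∑ s : ZMod 3, ‖v (s + 1) + ZMod.stdAddChar a * v (s + 2)‖ ^ 2) =
      4 * cnsq (twAvg (ZMod.stdAddChar a) v) := by
    rw [show (∑ s : ZMod 3, ‖v (s + 1) + ZMod.stdAddChar a * v (s + 2)‖ ^ 2) =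
      ‖v (0 + 1) + ZMod.stdAddChar a * v (0 + 2)‖ ^ 2 + ‖v (1 + 1) + ZMod.stdAddChar a * v (1 + 2)‖ ^ 2 +
      ‖v (2 + 1) + ZMod.stdAddChar a * v (2 + 2)‖ ^ 2 from
      Fin.sum_univ_three (fun s : ZMod 3 => ‖v (s + 1) + ZMod.stdAddChar a * v (s + 2)‖ ^ 2)]
    unfold cnsq twAvg
    simp only [norm_div, Complex.norm_ofNat, div_pow]
    ring
  have hr : (∑ s : ZMod 3, ‖v s‖ ^ 2) = cnsq v := Fin.sum_univ_three (fun s : ZMod 3 => ‖v s‖ ^ 2)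
  rw [hl, hr] at h
  nlinarith [cnsq_nonneg v, sq_nonneg (Real.cos (Real.pi / (3 * M)))]

/-- `0 ≤ cos(π/(3M))` for `M ≥ 1`. -/
theorem cos_nonneg (M : ℕ) [NeZero M] : 0 ≤ Real.cos (Real.pi / (3 * M)) := by
  have hM : (1 : ℝ) ≤ M := by exact_mod_cast Nat.one_le_iff_ne_zero.2 (NeZero.ne M)
  apply Real.cos_nonneg_of_neg_pi_div_two_le_of_le
  · have : 0 ≤ Real.pi / (3 * M) := by positivity
    linarith [Real.pi_pos]
  · rw [div_le_div_iff₀ (by positivity) (by norm_num)]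
    nlinarith [Real.pi_pos]

/-- **The all-ones twist**: for `3 ∤ M` and `j ≠ 0` in `ℤ/M`, `|Σ_u [WIN_Y(u)]·e_M(j·|u|)| ≤ 3·cos(π/(3M))ⁿ·2ⁿ`. -/
theorem corr_win_weight_le (hM3 : M.Coprime 3) (c : ℕ) (Y : Finset (Fin (n + 1))) {j : ZMod M} (hj : j ≠ 0) :
    ‖∑ u : Fin n → Bool, (if ringWinU c (fun g _ => decide (g ∈ Y)) u = true then (1 : ℂ) else 0) *
        (ZMod.stdAddChar (∑ i : Fin n, if u i then j else 0) : ℂ)‖ ≤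
      3 * Real.cos (Real.pi / (3 * M)) ^ n * (2 : ℝ) ^ n := by
  have h := corr_win_le (cos_nonneg M) (fun a ha v => site_contract hM3 ha v) c Y (fun _ : Fin n => j)
  have hcard : (univ.filter fun _ : Fin n => j ≠ 0).card = n := by
    rw [Finset.filter_true_of_mem (fun _ _ => hj), Finset.card_univ, Fintype.card_fin]
  rwa [hcard] at h

end TwistM

end Summit.QuantumAdvantage.QuantumAdvantage.Theorems.DigitDial
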